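import Summits.CriticalPhenomena.PercolationContinuityZ3.Theorems.PercNearOneGluingNoHeavyLowerTailKnQuestion8CoefficientwiseMirrorPendant
import Summits.CriticalPhenomena.PercolationContinuityZ3.Theorems.PercNearOneGluingNoHeavyLowerTailKnQuestion8CoefficientwiseZoneFlip
import HarnessLib

/-!
# Weighted one-sided mirror sums and the clusters of a leaf (tools for the CROSS row)

Support file (`--supports stmt-CriticalPhenomena-4575`, closed), prover `prim-cplus-coupling` (gen 28).  No definitions, no notations, no named
facts, no sorries; standard axioms.  Memo `prim-cplus-coupling/A5-COUPLING-gen28.md` §1 (CROSS / GRAND), HANDOFF (3).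

Setting as in …CoefficientwiseMirror: colourings `s : Finset ι` of a finite multigraph `ends : ι → Sym2 V`, `C_v(s) = openCluster (ends '' s) v`; the cluster pair of
`x` is `X = (C_x s, C_x sᶜ)`, that of `z` is `Y = (C_z s, C_z sᶜ)`; mirror test functions `ψ, θ` are antisymmetric and monotone in the first argument.
CONJECTURE CROSS (gen 28; the cross terms of GRAND = the 2-colouring shadow of vdBHK Thm 1.5 ⊗ 1.5; it contains the antipodal rows aBHK / AMASTER of gens 22–24):
  `Σ_{s : z ∉ C_x s, z ∉ C_x sᶜ} ψ(X(s))·θ(Y(s)) ≤ 0`   ('the x-advantage and the z-advantage are obtuse').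
Exact census: 0 violations on all graphs with ≤ 7 vertices and all hypergraphs with ≤ 5 vertices (memo §3).  This file proves:
* `Coefficientwise.mirror_cell_sum_nonpos` — on a cell, the sum of one mirror test function of the pair is `≤ 0` (the half of `mirror_cell_nonneg` that is reused);
* `Coefficientwise.mirror_offCluster_weighted_nonpos` — for a vertex set `A` and a nonnegative weight `w` of the red cluster `R_A(s)` of `A`:
  `Σ_{s : A ∩ C_x(s) = ∅} w(R_A(s))·ψ(X(s)) ≤ 0` (cells of `R_A`; `w` is constant on a cell);
* `Coefficientwise.mirror_offCluster_weighted_nonpos_sub` — the same on the colourings of an edge subset `E'`;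
* `Coefficientwise.openCluster_leaf_eq`, `Coefficientwise.openCluster_leaf_insert` — the clusters of a leaf `z`: `{z}` without its edge, `insert z (C_v u)` with it;
The companion file …CoefficientwiseCrossPendant proves CROSS for a pendant `z` from these.
[cite: KozmaNitzan2024, Questions 8–9 (§5.5 p. 36) (context: the Question-8 pocket covariance programme)]
-/

namespace Summit.CriticalPhenomena.PercolationContinuityZ3.Theorems

open Finset Literature.Probability.Percolation

namespace Coefficientwise

variable {ι V : Type*}

section cells
variable [Fintype ι] [DecidableEq ι]

/-- **Cell sum of one mirror test function.**  `π ⊆ B`; `K` monotone with `K t ⊆ K ((B \ π) ∪ (t \ B))` on the cell `{t | t ∩ B = π}`; `ψ` antisymmetric and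
monotone in the first argument.  Then `Σ_{cell} ψ(K t, K tᶜ) ≤ 0` (pair `t` with the free flip `τ t = π ∪ (tᶜ \ B)`, for which `(K(τt), K((τt)ᶜ)) ≤_tw (K tᶜ, K t)`).
[this work] -/
theorem mirror_cell_sum_nonpos (B π : Finset ι) (hπ : π ⊆ B) (K : Finset ι → Set V)
    (hKle : ∀ t : Finset ι, t ∩ B = π → K t ⊆ K ((B \ π) ∪ (t \ B)))
    (ψ : Set V → Set V → ℝ) (ha : ∀ a b, ψ a b = -ψ b a) (hm : ∀ a a' b, a ⊆ a' → ψ a b ≤ ψ a' b) :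
    ∑ t ∈ univ.filter (fun t : Finset ι => t ∩ B = π), ψ (K t) (K tᶜ) ≤ 0 := by
  set cell := univ.filter (fun t : Finset ι => t ∩ B = π) with hcell
  have mem_cell : ∀ t : Finset ι, t ∈ cell ↔ t ∩ B = π := fun t => by simp [hcell]
  have hm' : ∀ a b b', b ⊆ b' → ψ a b' ≤ ψ a b := fun a b b' hbb => by
    rw [ha a b', ha a b]; linarith [hm b b' a hbb]
  set τ : Finset ι → Finset ι := fun t => π ∪ (tᶜ \ B) with hτ
  have facts : ∀ t : Finset ι, t ∩ B = π → ∀ i, (i ∈ π ↔ i ∈ t ∧ i ∈ B) := fun t ht i => by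
    rw [← ht]; exact Finset.mem_inter
  have memτ : ∀ t i, i ∈ τ t ↔ i ∈ π ∨ (i ∉ t ∧ i ∉ B) := fun t i => by
    simp only [hτ, Finset.mem_union, Finset.mem_sdiff, Finset.mem_compl]
  have hτcell : ∀ t, t ∩ B = π → τ t ∩ B = π := by
    intro t ht; ext i; simp only [Finset.mem_inter, memτ]
    have h1 := facts t ht i; have h2 : i ∈ π → i ∈ B := fun h => hπ h; tauto
  have hττ : ∀ t, t ∩ B = π → τ (τ t) = t := by
    intro t ht; ext i; rw [memτ, memτ]
    have h1 := facts t ht i; have h2 : i ∈ π → i ∈ B := fun h => hπ h; tauto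
  have hflip : ∀ t, t ∩ B = π → tᶜ = (B \ π) ∪ (τ t \ B) := by
    intro t ht; ext i; simp only [Finset.mem_compl, Finset.mem_union, Finset.mem_sdiff, memτ]
    have h1 := facts t ht i; have h2 : i ∈ π → i ∈ B := fun h => hπ h; tauto
  have hKτ : ∀ t, t ∩ B = π → K (τ t) ⊆ K tᶜ := by
    intro t ht; have h := hKle (τ t) (hτcell t ht); rw [← hflip t ht] at h; exact h
  have hKτc : ∀ t, t ∩ B = π → K t ⊆ K (τ t)ᶜ := by
    intro t ht
    have e : (τ t)ᶜ = (B \ π) ∪ (t \ B) := by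
      have := hflip (τ t) (hτcell t ht); rw [hττ t ht] at this; exact this
    rw [e]; exact hKle t ht
  have pair_le : ∀ t, t ∩ B = π → ψ (K (τ t)) (K (τ t)ᶜ) ≤ -ψ (K t) (K tᶜ) := by
    intro t ht
    calc ψ (K (τ t)) (K (τ t)ᶜ) ≤ ψ (K tᶜ) (K (τ t)ᶜ) := hm _ _ _ (hKτ t ht)
      _ ≤ ψ (K tᶜ) (K t) := hm' _ _ _ (hKτc t ht)
      _ = -ψ (K t) (K tᶜ) := ha _ _
  have reindex : ∑ t ∈ cell, ψ (K (τ t)) (K (τ t)ᶜ) = ∑ t ∈ cell, ψ (K t) (K tᶜ) := by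
    refine Finset.sum_bij' (fun t _ => τ t) (fun t _ => τ t) ?_ ?_ ?_ ?_ ?_
    · intro t ht; exact (mem_cell _).mpr (hτcell t ((mem_cell t).mp ht))
    · intro t ht; exact (mem_cell _).mpr (hτcell t ((mem_cell t).mp ht))
    · intro t ht; exact hττ t ((mem_cell t).mp ht)
    · intro t ht; exact hττ t ((mem_cell t).mp ht)
    · intro t ht; rfl
  have h2 : 2 * ∑ t ∈ cell, ψ (K t) (K tᶜ) = ∑ t ∈ cell, (ψ (K t) (K tᶜ) + ψ (K (τ t)) (K (τ t)ᶜ)) := by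
    rw [Finset.sum_add_distrib, reindex]; ring
  have h3 : ∑ t ∈ cell, (ψ (K t) (K tᶜ) + ψ (K (τ t)) (K (τ t)ᶜ)) ≤ 0 := by
    refine Finset.sum_nonpos fun t ht => ?_
    have := pair_le t ((mem_cell t).mp ht)
    linarith
  linarith

open Classical in
/-- **Weighted one-sided mirror sum.**  For a vertex set `A`, a weight `w : Set V → ℝ` with `0 ≤ w` and a mirror test function `ψ`:
`Σ_{s : A ∩ C_x(s) = ∅} w(R_A(s))·ψ(C_x s, C_x sᶜ) ≤ 0`, where `R_A(s) = {y | ∃ a ∈ A, y ∈ C_a(s)}` is the red cluster of `A` (constant on its cells).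
[this work] -/
theorem mirror_offCluster_weighted_nonpos (ends : ι → Sym2 V) (x : V) (A : Set V) (w : Set V → ℝ) (hw : ∀ S, 0 ≤ w S)
    (ψ : Set V → Set V → ℝ) (ha : ∀ a b, ψ a b = -ψ b a) (hm : ∀ a a' b, a ⊆ a' → ψ a b ≤ ψ a' b) :
    ∑ s ∈ univ.filter (fun s : Finset ι => ∀ a ∈ A, a ∉ openCluster (ends '' (↑s : Set ι)) x),
      w {y | ∃ a ∈ A, y ∈ openCluster (ends '' (↑s : Set ι)) a} *
        ψ (openCluster (ends '' (↑s : Set ι)) x) (openCluster (ends '' (↑(sᶜ) : Set ι)) x) ≤ 0 := by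
  set K : Finset ι → Set V := fun s => openCluster (ends '' (↑s : Set ι)) x with hK
  set R : Finset ι → Set V := fun s => {y | ∃ a ∈ A, y ∈ openCluster (ends '' (↑s : Set ι)) a} with hR
  set D : Finset (Finset ι) := univ.filter (fun s : Finset ι => ∀ a ∈ A, a ∉ openCluster (ends '' (↑s : Set ι)) x) with hD
  change ∑ s ∈ D, w (R s) * ψ (K s) (K sᶜ) ≤ 0
  have hKmono : ∀ {s t : Finset ι}, s ⊆ t → K s ⊆ K t := fun hst => openCluster_image_mono ends hst x
  set I : Set V → Finset ι := fun S => univ.filter (fun i : ι => ∃ v ∈ S, v ∈ ends i) with hI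
  set key : Finset ι → Set V × Finset ι := fun s => (R s, s ∩ I (R s)) with hkey
  have R_closed : ∀ (s : Finset ι) {u w : V}, u ∈ R s → (openGraph (ends '' (↑s : Set ι))).Adj u w → w ∈ R s := by
    intro s u w hu hadj
    obtain ⟨a, haA, hau⟩ := hu
    exact ⟨a, haA, SimpleGraph.Reachable.trans hau hadj.reachable⟩
  have mem_I : ∀ (S : Set V) (i : ι) (v : V), v ∈ S → v ∈ ends i → i ∈ I S := by
    intro S i v hv hvi
    simp only [hI, Finset.mem_filter, Finset.mem_univ, true_and]
    exact ⟨v, hv, hvi⟩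
  have A_sub_R : ∀ (s : Finset ι), ∀ a ∈ A, a ∈ R s := fun s a ha => ⟨a, ha, mem_openCluster_self _ a⟩
  have locality : ∀ s₀ t : Finset ι, t ∩ I (R s₀) = s₀ ∩ I (R s₀) → R t = R s₀ := by
    intro s₀ t ht
    have agree : ∀ i, i ∈ I (R s₀) → (i ∈ t ↔ i ∈ s₀) := by
      intro i hi
      have := congrArg (fun u : Finset ι => i ∈ u) ht
      simp only [Finset.mem_inter, hi, and_true, eq_iff_iff] at this
      exact this
    have h1 : ∀ u ∈ R s₀, ∀ w, (openGraph (ends '' (↑s₀ : Set ι))).Adj u w →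
        (openGraph (ends '' (↑t : Set ι))).Adj u w ∧ w ∈ R s₀ := by
      intro u hu w hadj
      refine ⟨?_, R_closed s₀ hu hadj⟩
      rw [openGraph_image_adj] at hadj ⊢
      obtain ⟨⟨i, his, hi⟩, hne⟩ := hadj
      have hiI : i ∈ I (R s₀) := mem_I _ i u hu (by rw [hi]; exact Sym2.mem_mk_left u w)
      exact ⟨⟨i, (agree i hiI).mpr his, hi⟩, hne⟩
    have h2 : ∀ u ∈ R s₀, ∀ w, (openGraph (ends '' (↑t : Set ι))).Adj u w →
        (openGraph (ends '' (↑s₀ : Set ι))).Adj u w ∧ w ∈ R s₀ := by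
      intro u hu w hadj
      have hadj' : (openGraph (ends '' (↑s₀ : Set ι))).Adj u w := by
        rw [openGraph_image_adj] at hadj ⊢
        obtain ⟨⟨i, hit, hi⟩, hne⟩ := hadj
        have hiI : i ∈ I (R s₀) := mem_I _ i u hu (by rw [hi]; exact Sym2.mem_mk_left u w)
        exact ⟨⟨i, (agree i hiI).mp hit, hi⟩, hne⟩
      exact ⟨hadj', R_closed s₀ hu hadj'⟩
    ext y
    constructor
    · rintro ⟨a, haA, hay⟩
      obtain ⟨p⟩ := hay
      exact ((reachable_transfer (R s₀) h2 p) (A_sub_R s₀ a haA)).2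
    · rintro ⟨a, haA, hay⟩
      obtain ⟨p⟩ := hay
      exact ⟨a, haA, ((reachable_transfer (R s₀) h1 p) (A_sub_R s₀ a haA)).1⟩
  rw [← Finset.sum_fiberwise_of_maps_to (s := D) (t := D.image key) (g := key)
    (fun s hs => Finset.mem_image_of_mem key hs)]
  refine Finset.sum_nonpos fun k hk => ?_
  obtain ⟨s₀, hs₀D, rfl⟩ := Finset.mem_image.mp hk
  have hs₀ : ∀ a ∈ A, a ∉ K s₀ := by
    have := (Finset.mem_filter.mp hs₀D).2
    simpa [hK] using this
  set S₀ : Set V := R s₀ with hS₀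
  set B : Finset ι := I S₀ with hB
  set π : Finset ι := s₀ ∩ B with hπ
  have hxS₀ : x ∉ S₀ := by
    rintro ⟨a, haA, hax⟩
    exact hs₀ a haA (SimpleGraph.Reachable.symm hax)
  have fiber_eq : D.filter (fun t => key t = key s₀) = univ.filter (fun t : Finset ι => t ∩ B = π) := by
    ext t
    simp only [Finset.mem_filter, Finset.mem_univ, true_and]
    constructor
    · rintro ⟨_, hkt⟩
      have h1 : R t = S₀ := (Prod.ext_iff.mp hkt).1
      have h2 : t ∩ I (R t) = s₀ ∩ I (R s₀) := (Prod.ext_iff.mp hkt).2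
      rw [h1] at h2
      exact h2
    · intro ht
      have hRt : R t = S₀ := locality s₀ t ht
      refine ⟨?_, ?_⟩
      · rw [hD, Finset.mem_filter]
        refine ⟨Finset.mem_univ _, fun a haA hax => ?_⟩
        have hxRt : x ∈ R t := ⟨a, haA, SimpleGraph.Reachable.symm hax⟩
        rw [hRt] at hxRt
        exact hxS₀ hxRt
      · change (R t, t ∩ I (R t)) = (R s₀, s₀ ∩ I (R s₀))
        rw [hRt]
        exact Prod.ext rfl ht
  rw [fiber_eq]
  have offcluster : ∀ t : Finset ι, t ∩ B = π → K t ⊆ K ((B \ π) ∪ (t \ B)) := by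
    intro t ht
    have agree : ∀ i, i ∈ B → (i ∈ t ↔ i ∈ s₀) := by
      intro i hi
      have := congrArg (fun u : Finset ι => i ∈ u) ht
      simp only [hπ, Finset.mem_inter, hi, and_true, eq_iff_iff] at this
      exact this
    have htr : ∀ u ∈ S₀ᶜ, ∀ w, (openGraph (ends '' (↑t : Set ι))).Adj u w →
        (openGraph (ends '' (↑(t \ B) : Set ι))).Adj u w ∧ w ∈ S₀ᶜ := by
      intro u hu w hadj
      rw [openGraph_image_adj] at hadj
      obtain ⟨⟨i, hit, hi⟩, hne⟩ := hadj
      have hiB : i ∉ B := by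
        intro hiB
        have his₀ : i ∈ s₀ := (agree i hiB).mp hit
        have hiB' := hiB
        simp only [hB, hI, Finset.mem_filter, Finset.mem_univ, true_and] at hiB'
        obtain ⟨v, hvS, hvi⟩ := hiB'
        rw [hi, Sym2.mem_iff] at hvi
        rcases hvi with rfl | rfl
        · exact hu hvS
        · have hadj₀ : (openGraph (ends '' (↑s₀ : Set ι))).Adj v u := by
            rw [openGraph_image_adj]
            exact ⟨⟨i, his₀, by rw [hi, Sym2.eq_swap]⟩, hne.symm⟩
          exact hu (R_closed s₀ hvS hadj₀)
      have hwS : w ∈ S₀ᶜ := by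
        intro hwS
        exact hiB (mem_I S₀ i w hwS (by rw [hi]; exact Sym2.mem_mk_right u w))
      refine ⟨?_, hwS⟩
      rw [openGraph_image_adj]
      exact ⟨⟨i, Finset.mem_sdiff.mpr ⟨hit, hiB⟩, hi⟩, hne⟩
    intro y hy
    obtain ⟨p⟩ := hy
    have hreach := ((reachable_transfer S₀ᶜ htr p) hxS₀).1
    exact hKmono Finset.subset_union_right hreach
  -- the weight is the constant `w S₀` on the cell
  have hconst : ∀ t ∈ univ.filter (fun t : Finset ι => t ∩ B = π), w (R t) * ψ (K t) (K tᶜ) = w S₀ * ψ (K t) (K tᶜ) := by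
    intro t ht
    have ht' : t ∩ B = π := by simpa using ht
    rw [locality s₀ t ht']
  rw [Finset.sum_congr rfl hconst, ← Finset.mul_sum]
  exact mul_nonpos_of_nonneg_of_nonpos (hw S₀)
    (mirror_cell_sum_nonpos B π Finset.inter_subset_right K offcluster ψ ha hm)

end cells

section leaf
variable [DecidableEq ι]

omit [DecidableEq ι] in
/-- Without its edge the leaf `z` is isolated: `C_z(t) = {z}` if `e₀ ∉ t`. [this work] -/
theorem openCluster_leaf_eq (ends : ι → Sym2 V) {z : V} {e₀ : ι} (hpend : ∀ i, z ∈ ends i → i = e₀)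
    {t : Finset ι} (ht : e₀ ∉ t) : openCluster (ends '' (↑t : Set ι)) z = {z} := by
  ext y
  constructor
  · intro hy
    obtain ⟨p⟩ := hy
    have htr : ∀ u ∈ ({z} : Set V), ∀ w, (openGraph (ends '' (↑t : Set ι))).Adj u w →
        (⊤ : SimpleGraph V).Adj u w ∧ w ∈ ({z} : Set V) := by
      intro u hu w hadj
      exfalso
      rw [Set.mem_singleton_iff] at hu
      subst hu
      rw [openGraph_image_adj] at hadj
      obtain ⟨⟨i, hit, hi⟩, _⟩ := hadj
      have : i = e₀ := hpend i (by rw [hi]; exact Sym2.mem_mk_left _ w)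
      exact ht (this ▸ hit)
    exact ((reachable_transfer ({z} : Set V) htr p) rfl).2
  · intro hy
    rw [Set.mem_singleton_iff] at hy
    subst hy
    exact mem_openCluster_self _ _

/-- With its edge `e₀ = {z,v}` the cluster of the leaf `z` is `{z} ∪ C_v(u)` (`e₀ ∉ u`). [this work] -/
theorem openCluster_leaf_insert (ends : ι → Sym2 V) {z v : V} {e₀ : ι} (he₀ : ends e₀ = s(z, v))
    (hpend : ∀ i, z ∈ ends i → i = e₀) (hzv : z ≠ v) {u : Finset ι} (hu : e₀ ∉ u) :
    openCluster (ends '' (↑(insert e₀ u) : Set ι)) z = insert z (openCluster (ends '' (↑u : Set ι)) v) := by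
  set Cv : Set V := openCluster (ends '' (↑u : Set ι)) v with hCv
  ext y
  constructor
  · intro hy
    obtain ⟨p⟩ := hy
    have htr : ∀ a ∈ insert z Cv, ∀ w, (openGraph (ends '' (↑(insert e₀ u) : Set ι))).Adj a w →
        (⊤ : SimpleGraph V).Adj a w ∧ w ∈ insert z Cv := by
      intro a ha w hadj
      rw [openGraph_image_adj] at hadj
      obtain ⟨⟨i, hit, hi⟩, hne⟩ := hadj
      refine ⟨(SimpleGraph.top_adj a w).mpr hne, ?_⟩
      rcases Finset.mem_insert.mp hit with rfl | hiu
      · -- the edge `e₀`: `w ∈ {z, v}`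
        have hw : w ∈ s(z, v) := by rw [← he₀, hi]; exact Sym2.mem_mk_right a w
        rcases Sym2.mem_iff.mp hw with rfl | rfl
        · exact Set.mem_insert _ _
        · exact Set.mem_insert_of_mem _ (mem_openCluster_self _ _)
      · -- an edge of `u`: then `a ≠ z` (else `i = e₀ ∈ u`), so `a ∈ Cv` and `w ∈ Cv`
        have haz : a ≠ z := by
          intro haz
          subst haz
          have : i = e₀ := hpend i (by rw [hi]; exact Sym2.mem_mk_left _ w)
          exact hu (this ▸ hiu)
        have haCv : a ∈ Cv := by
          rcases (Set.mem_insert_iff).mp ha with h | h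
          · exact absurd h haz
          · exact h
        exact Set.mem_insert_of_mem _
          (mem_openCluster_of_mem_ends ends u v hiu haCv (by rw [hi]; exact Sym2.mem_mk_left a w)
            (by rw [hi]; exact Sym2.mem_mk_right a w))
    exact ((reachable_transfer (insert z Cv) htr p) (Set.mem_insert _ _)).2
  · intro hy
    rcases (Set.mem_insert_iff).mp hy with rfl | hyv
    · exact mem_openCluster_self _ _
    · have hzv' : (openGraph (ends '' (↑(insert e₀ u) : Set ι))).Adj z v := by
        rw [openGraph_image_adj]
        exact ⟨⟨e₀, Finset.mem_insert_self e₀ u, he₀⟩, hzv⟩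
      have hvy : v ∈ openCluster (ends '' (↑(insert e₀ u) : Set ι)) v → y ∈ openCluster (ends '' (↑(insert e₀ u) : Set ι)) v :=
        fun _ => openCluster_image_mono ends (Finset.subset_insert e₀ u) v hyv
      exact SimpleGraph.Reachable.trans hzv'.reachable (hvy (mem_openCluster_self _ _))

end leaf

section pendant
variable [DecidableEq ι]

open Classical in
/-- The weighted one-sided mirror sum on the colourings of an edge subset `E'` (transport of `mirror_offCluster_weighted_nonpos` along `{i // i ∈ E'}`,
as in prim-lf-2's `offCluster_twoColouring_nonneg_sub`). [this work] -/
theorem mirror_offCluster_weighted_nonpos_sub (ends : ι → Sym2 V) (E' : Finset ι) (x : V) (A : Set V) (w : Set V → ℝ) (hw : ∀ S, 0 ≤ w S)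
    (ψ : Set V → Set V → ℝ) (ha : ∀ a b, ψ a b = -ψ b a) (hm : ∀ a a' b, a ⊆ a' → ψ a b ≤ ψ a' b) :
    ∑ t ∈ E'.powerset.filter (fun t : Finset ι => ∀ a ∈ A, a ∉ openCluster (ends '' (↑t : Set ι)) x),
      w {y | ∃ a ∈ A, y ∈ openCluster (ends '' (↑t : Set ι)) a} *
        ψ (openCluster (ends '' (↑t : Set ι)) x) (openCluster (ends '' (↑(E' \ t) : Set ι)) x) ≤ 0 := by
  set emb : {i // i ∈ E'} ↪ ι := Function.Embedding.subtype _ with hemb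
  have key := mirror_offCluster_weighted_nonpos (ends ∘ Subtype.val : {i // i ∈ E'} → Sym2 V) x A w hw ψ ha hm
  have map_compl : ∀ t : Finset {i // i ∈ E'}, (tᶜ).map emb = E' \ t.map emb := by
    intro t
    ext i
    simp only [Finset.mem_map, Finset.mem_compl, Finset.mem_sdiff, hemb, Function.Embedding.coe_subtype]
    constructor
    · rintro ⟨⟨j, hj⟩, hjt, rfl⟩
      exact ⟨hj, fun ⟨⟨k, hk⟩, hkt, hkj⟩ => hjt (by cases hkj; exact hkt)⟩
    · rintro ⟨hiE, hnot⟩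
      exact ⟨⟨i, hiE⟩, fun hit => hnot ⟨⟨i, hiE⟩, hit, rfl⟩, rfl⟩
  have map_sub : ∀ t : Finset {i // i ∈ E'}, t.map emb ⊆ E' := by
    intro t i hi
    obtain ⟨⟨j, hj⟩, _, rfl⟩ := Finset.mem_map.mp hi
    exact hj
  refine le_of_eq_of_le (Eq.symm ?_) key
  refine Finset.sum_bij' (fun t _ => t.map emb) (fun t _ => t.subtype (· ∈ E')) ?_ ?_ ?_ ?_ ?_
  · intro t ht
    rw [Finset.mem_filter] at ht ⊢
    refine ⟨Finset.mem_powerset.mpr (map_sub t), ?_⟩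
    rw [← image_map_subtype]; exact ht.2
  · intro t ht
    rw [Finset.mem_filter] at ht ⊢
    refine ⟨Finset.mem_univ _, ?_⟩
    have hsub : t ⊆ E' := Finset.mem_powerset.mp ht.1
    rw [image_map_subtype, Finset.subtype_map_of_mem (fun i hi => hsub hi)]
    exact ht.2
  · intro t _
    ext ⟨i, hi⟩
    rw [Finset.mem_subtype, Finset.mem_map]
    constructor
    · rintro ⟨⟨j, hj⟩, hjt, hji⟩
      have hji' : j = i := by simpa [hemb] using hji
      subst hji'
      exact hjt
    · intro h
      exact ⟨⟨i, hi⟩, h, by simp [hemb]⟩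
  · intro t ht
    have hsub : t ⊆ E' := Finset.mem_powerset.mp (Finset.mem_filter.mp ht).1
    exact Finset.subtype_map_of_mem (fun i hi => hsub hi)
  · intro t _
    rw [image_map_subtype, image_map_subtype ends E' (tᶜ), map_compl]

end pendant

end Coefficientwise

end Summit.CriticalPhenomena.PercolationContinuityZ3.Theorems
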